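import Literature.MathematicalPhysics.QuantumLattice.HubbardGridCounterQuadratic
import HarnessLib

/-!
# The pinned `ℓ¹` kernel norm of the grid counterterm vertex `𝒩_{K,N}` through the INTRINSIC size `Σ_z ‖Ǩ_L(z)‖`

Topic `MathematicalPhysics/QuantumLattice`; a sibling of `HubbardGridCounterQuadratic` §CounterKernels.  There the pinned `ℓ¹` norm of
the `2`-point kernel of `𝒩_{K,N} = hubbardGridCounterQuadratic L N β K` is bounded by `(|β|/N)·coeffNorm 0 K`; but `coeffNorm 0 K`
(the `ℓ¹` weight of the COEFFICIENT TABLE) depends on the presentation of the frame (`TrigPolyC4v.coeff` need not be symmetric while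
`harmonic m n = harmonic n m`), whereas every a-priori class of frames (`FrameOK` of the KL programme) constrains only `K.eval`.  The
intrinsic quantity is the `ℓ¹` size `Σ_{z ∈ (ℤ/L)²} ‖Ǩ_L(z)‖` of the lattice position kernel `framePosKernel L K` through which `𝒩_{K,N}`
is DEFINED; the proofs of §CounterKernels pass through exactly this sum.  Here the three pinned bounds are restated with it:

* `sum_filter_plusLeg_norm_coeff_le_l1`, `sum_filter_minusLeg_norm_coeff_le_l1` — the `ψ⁺`- and `ψ⁻`-pinned coefficient sums
  `≤ (|β|/N)·Σ_z ‖Ǩ_L(z)‖`;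
* **`sum_norm_kernel_hubbardGridCounterQuadratic_le_l1`** — `Σ_{Y : Y p = w} ‖kernel 𝒩_{K,N} 2 Y‖ ≤ (|β|/N)·Σ_z ‖Ǩ_L(z)‖` for every leg
  `w` and both slots `p` (the `N(1)` input of the determinant-bounded step with an eval-determined profile).

Everything is proved (same proofs as §CounterKernels minus their last step); no definitions, no named facts.

## Sources

G. Benfatto, A. Giuliani, V. Mastropietro, Ann. Henri Poincaré 4 (2003) 137–193, §1.2 (2.10) [`BenfattoGiulianiMastropietro2003`].
-/

noncomputable section

namespace Literature.MathematicalPhysics.QuantumLattice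

open GrassmannAlgebra Finset Literature.Probability.LatticeModels

variable {L N : ℕ} [NeZero L]

/-- **The `ψ⁺`-pinned coefficient sum of the grid counterterm**: for every leg `w`, the coefficients of the monomials whose `ψ⁺` leg
is `w` have total size `≤ (|β|/N)·Σ_z ‖Ǩ_L(z)‖` (the INTRINSIC `ℓ¹` size of the lattice position kernel) (they are `ε_N Ǩ_L(x⃗_w − y⃗)`, `y⃗ ∈ (ℤ/Lℤ)²`). [cite: BenfattoGiulianiMastropietro2003, §1.2 The model (2.10)] -/
theorem sum_filter_plusLeg_norm_coeff_le_l1 (β : ℝ) (K : TrigPolyC4v) (w : GridLeg (GridPoint L N)) :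
    ∑ i ∈ (univ : Finset (Fin 2 × (GridPoint L N × TorusSite 2 L))).filter
        (fun i => ((((i.2.1, i.1), 0) : GridLeg (GridPoint L N))) = w),
      ‖(((β / N : ℝ)) : ℂ) * framePosKernel L K (i.2.1.2 - i.2.2)‖ ≤ |β| / N * ∑ z : TorusSite 2 L, ‖framePosKernel L K z‖ := by
  set s := (univ : Finset (Fin 2 × (GridPoint L N × TorusSite 2 L))).filter
    (fun i => ((((i.2.1, i.1), 0) : GridLeg (GridPoint L N))) = w) with hs
  -- on `s`, the point `i.2.1` is `w.1.1`, so the summand is a function of `y = i.2.2`, and `i ↦ i.2.2` is injective on `s`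
  have hmem : ∀ i ∈ s, i.2.1 = w.1.1 ∧ i.1 = w.1.2 := by
    intro i hi
    rw [hs, mem_filter] at hi
    have h := hi.2
    exact ⟨by rw [← h], by rw [← h]⟩
  have hinj : Set.InjOn (fun i : Fin 2 × (GridPoint L N × TorusSite 2 L) => i.2.2) s := by
    intro i hi i' hi' h
    obtain ⟨h1, h2⟩ := hmem i hi
    obtain ⟨h1', h2'⟩ := hmem i' hi'
    exact Prod.ext (h2.trans h2'.symm) (Prod.ext (h1.trans h1'.symm) h)
  set g : TorusSite 2 L → ℝ := fun y => |β| / N * ‖framePosKernel L K (w.1.1.2 - y)‖ with hg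
  have hcongr : ∀ i ∈ s, ‖(((β / N : ℝ)) : ℂ) * framePosKernel L K (i.2.1.2 - i.2.2)‖ = g i.2.2 := by
    intro i hi
    rw [hg, (hmem i hi).1, norm_mul, Complex.norm_real, Real.norm_eq_abs, abs_div, Nat.abs_cast]
  have hg0 : ∀ y, 0 ≤ g y := fun y => by rw [hg]; positivity
  calc ∑ i ∈ s, ‖(((β / N : ℝ)) : ℂ) * framePosKernel L K (i.2.1.2 - i.2.2)‖ = ∑ i ∈ s, g i.2.2 := sum_congr rfl hcongr
    _ = ∑ y ∈ s.image (fun i : Fin 2 × (GridPoint L N × TorusSite 2 L) => i.2.2), g y := (sum_image hinj).symm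
    _ ≤ ∑ y : TorusSite 2 L, g y := sum_le_sum_of_subset_of_nonneg (subset_univ _) fun y _ _ => hg0 y
    _ = |β| / N * ∑ z : TorusSite 2 L, ‖framePosKernel L K z‖ := by
        rw [hg, ← mul_sum]
        congr 1
        exact Fintype.sum_equiv (Equiv.subLeft w.1.1.2) _ _ fun y => by simp [Equiv.subLeft]

/-- **The `ψ⁻`-pinned coefficient sum of the grid counterterm**: for every leg `w`, the coefficients of the monomials whose `ψ⁻` leg
is `w` have total size `≤ (|β|/N)·Σ_z ‖Ǩ_L(z)‖` (the INTRINSIC `ℓ¹` size of the lattice position kernel) (they are `ε_N Ǩ_L(x⃗ − y⃗_w)`, `x⃗ ∈ (ℤ/Lℤ)²`). [cite: BenfattoGiulianiMastropietro2003, §1.2 The model (2.10)] -/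
theorem sum_filter_minusLeg_norm_coeff_le_l1 (β : ℝ) (K : TrigPolyC4v) (w : GridLeg (GridPoint L N)) :
    ∑ i ∈ (univ : Finset (Fin 2 × (GridPoint L N × TorusSite 2 L))).filter
        (fun i => (((((i.2.1.1, i.2.2), i.1), 1) : GridLeg (GridPoint L N))) = w),
      ‖(((β / N : ℝ)) : ℂ) * framePosKernel L K (i.2.1.2 - i.2.2)‖ ≤ |β| / N * ∑ z : TorusSite 2 L, ‖framePosKernel L K z‖ := by
  set s := (univ : Finset (Fin 2 × (GridPoint L N × TorusSite 2 L))).filter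
    (fun i => (((((i.2.1.1, i.2.2), i.1), 1) : GridLeg (GridPoint L N))) = w) with hs
  -- on `s`, the time `i.2.1.1`, the point `i.2.2` and the spin are those of `w`; `i ↦ i.2.1.2` is injective on `s`
  have hmem : ∀ i ∈ s, i.2.1.1 = w.1.1.1 ∧ i.2.2 = w.1.1.2 ∧ i.1 = w.1.2 := by
    intro i hi
    rw [hs, mem_filter] at hi
    have h := hi.2
    exact ⟨by rw [← h], by rw [← h], by rw [← h]⟩
  have hinj : Set.InjOn (fun i : Fin 2 × (GridPoint L N × TorusSite 2 L) => i.2.1.2) s := by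
    intro i hi i' hi' h
    obtain ⟨h1, h2, h3⟩ := hmem i hi
    obtain ⟨h1', h2', h3'⟩ := hmem i' hi'
    exact Prod.ext (h3.trans h3'.symm) (Prod.ext (Prod.ext (h1.trans h1'.symm) h) (h2.trans h2'.symm))
  set g : TorusSite 2 L → ℝ := fun x => |β| / N * ‖framePosKernel L K (x - w.1.1.2)‖ with hg
  have hcongr : ∀ i ∈ s, ‖(((β / N : ℝ)) : ℂ) * framePosKernel L K (i.2.1.2 - i.2.2)‖ = g i.2.1.2 := by
    intro i hi
    rw [hg, (hmem i hi).2.1, norm_mul, Complex.norm_real, Real.norm_eq_abs, abs_div, Nat.abs_cast]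
  have hg0 : ∀ x, 0 ≤ g x := fun x => by rw [hg]; positivity
  calc ∑ i ∈ s, ‖(((β / N : ℝ)) : ℂ) * framePosKernel L K (i.2.1.2 - i.2.2)‖ = ∑ i ∈ s, g i.2.1.2 := sum_congr rfl hcongr
    _ = ∑ x ∈ s.image (fun i : Fin 2 × (GridPoint L N × TorusSite 2 L) => i.2.1.2), g x := (sum_image hinj).symm
    _ ≤ ∑ x : TorusSite 2 L, g x := sum_le_sum_of_subset_of_nonneg (subset_univ _) fun x _ _ => hg0 x
    _ = |β| / N * ∑ z : TorusSite 2 L, ‖framePosKernel L K z‖ := by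
        rw [hg, ← mul_sum]
        congr 1
        exact Fintype.sum_equiv (Equiv.subRight w.1.1.2) _ _ fun x => by simp [Equiv.subRight]


/-- **The pinned `ℓ¹` norm of the grid counterterm's `2`-point kernel, intrinsic form**: for every leg `w` and both slots `p`,
`Σ_{Y : Y p = w} ‖kernel 𝒩_{K,N} 2 Y‖ ≤ (|β|/N)·Σ_z ‖Ǩ_L(z)‖`. [cite: BenfattoGiulianiMastropietro2003, §1.2 The model (2.10)] -/
theorem sum_norm_kernel_hubbardGridCounterQuadratic_le_l1 (β : ℝ) (K : TrigPolyC4v) (p : Fin 2) (w : GridLeg (GridPoint L N)) :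
    ∑ Y ∈ univ.filter (fun Y : Fin 2 → GridLeg (GridPoint L N) => Y p = w),
      ‖kernel ℂ (hubbardGridCounterQuadratic L N β K) 2 Y‖ ≤ |β| / N * ∑ z : TorusSite 2 L, ‖framePosKernel L K z‖ := by
  rw [hubbardGridCounterQuadratic_eq_sum]
  exact sum_norm_kernel_two_structured_le univ _ _ _ (sum_filter_plusLeg_norm_coeff_le_l1 β K)
    (sum_filter_minusLeg_norm_coeff_le_l1 β K) p w

/-- The intrinsic size is dominated by the coefficient weight of any presentation: `Σ_z ‖Ǩ_L(z)‖ ≤ coeffNorm 0 K`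
(`sum_norm_framePosKernel_le`, restated next to its use). [cite: BenfattoGiulianiMastropietro2003, §1.2 The model (2.10)] -/
theorem sum_norm_framePosKernel_le_coeffNorm (K : TrigPolyC4v) : ∑ z : TorusSite 2 L, ‖framePosKernel L K z‖ ≤ K.coeffNorm 0 :=
  sum_norm_framePosKernel_le K

end Literature.MathematicalPhysics.QuantumLattice

end
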